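import Summits.KontsevichZagierPeriods.KontsevichZagierPeriods.Theorems.KzOnePeriodsLadder
import Summits.KontsevichZagierPeriods.KontsevichZagierPeriods.Theorems.DessinsDimensionOneExcursionBudgetDimZero
import Summits.KontsevichZagierPeriods.KontsevichZagierPeriods.Theorems.AbelContractionRealHyperellipticSectorPortDimOneAssembly
import Summits.KontsevichZagierPeriods.KontsevichZagierPeriods.Theorems.AbelContractionRealHyperellipticSectorPortAlgSplitK5Kit
import Summits.KontsevichZagierPeriods.KontsevichZagierPeriods.Theorems.AbelContractionRealHyperellipticSectorBudgetKit
import Summits.KontsevichZagierPeriods.KontsevichZagierPeriods.Theses.DimensionBudget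
import Literature.NumberTheory.Transcendental.SemialgebraicAlgebraicPoints
import Literature.NumberTheory.Transcendental.SemialgebraicAlgebraicScaling
import Literature.NumberTheory.Transcendental.KZSemialgebraicComplex
import Literature.NumberTheory.Transcendental.KZBallPeelingAux

/-!
# KontsevichZagierPeriods — the TRUNCATED ladder `KZ_leLE d` through rung 1: what the tree decides, and where the gap sits

Cell pub-kz1p (KZ 1-periods), seat b2b-kz1p-1 (gen 3).  Companion of `KzOnePeriodsLadder.lean` (the rung predicates) and
`KzOnePeriodsGaps.lean` (status of the UNtruncated rungs `KZ_le 0`, `KZ_leRat 1`, `KZ_le 1`).  The cell's referee (R0-4) asked for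
the truncated codomain: `KZ_leLE d` = "two representations of dimensions `≤ d` with the same value are joined by moves among
representations of dimension `≤ d`" (`KZ.EquivalentLE d`, `Literature/…/KZRelationsLE.lean`).  This file records, kernel-checked
and by name, what the tree already settles about `KZ_leLE 0` and `KZ_leLE 1`, and identifies the cell's open gap G-LE1
(`KZ_leLE 1`) with statements ALREADY FILED by two routes of the summit — so that the gap is not a private hypothesis of the cell
but the negation of a staffable route item.

STATUS (all sorry-free, standard axioms; `ladder_statusLE` bundles it):
* truncated rung 0 — `KZ_leLE_zero : KZ_leLE 0` — PROVED here (ten lines; no transcendence input: `Set (Fin 0 → ℝ) = {∅, univ}`;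
  the budget-polymorphic congruence lemmas are REUSED from `Theorems/DessinsDimensionOneExcursionBudgetDimZero.lean`, whose item
  stmt-KontsevichZagierPeriods-14369 is the same statement with budget `1`);
* truncated RATIONAL rung 1 — PROVED IN TREE and cited by name (second conjunct of `ladder_statusLE`): it is
  `AbelContraction.RealHyperellipticSector.Port.Dlog.kzConjectureLE_of_dim_le_one` (Baker's theorem `baker_holds` + the
  dimension-certified normal form; = closed item stmt-KontsevichZagierPeriods-3750 `DimensionBudget.BakerSectorDimOne`);
* truncated rung 1 for ALL ℚ-semialgebraic representations — `KZ_leLE 1` — OPEN, and: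
  `KZ_leLE_one_iff_dimOne` reduces it to pairs of dimension exactly `1` (padding a point by ONE Newton–Leibniz move `1 → 0`
  inside the budget, REUSED `Port.AlgSplitK5.unit_slab_sub_pt_mem_relationsLE`), whence
  `KZ_leLE_one_iff_not_dimOneNeedsExcursion : KZ_leLE 1 ↔ ¬ DessinsDimensionOne.DimOneNeedsExcursion` — the cell's gap G-LE1 is
  EXACTLY the negation of the open route item stmt-KontsevichZagierPeriods-6266 (route DessinsDimensionOne bets `d(1) = 2`, i.e.
  that G-LE1 FAILS, with the pinned genus-2 Cauchy witness stmt-…-6260 `CauchyGenusTwoNotDimOne`); route DimensionBudget's open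
  crux stmt-…-3749 `DimOneNotConservative` also refutes it (`not_KZ_leLE_one_of_dimOneNotConservative`); and the budget-2
  weakenings stmt-…-6261 `DessinsDimensionOne.DimLeOneBudgetTwo` / stmt-…-3751 `DimensionBudget.DimOneWithinTwo` sit between
  `KZ_leLE 1` and `KZ_le 1` (`dimLeOneBudgetTwo_of_KZ_leLE_one`, `KZ_le_one_of_dimLeOneBudgetTwo`,
  `dimOneWithinTwo_of_dimLeOneBudgetTwo`).

Nothing here is new mathematics; the point is that the cell's truncated-ladder bookkeeping is a set of theorems about named tree
constants.  Sources: M. Kontsevich, D. Zagier, *Periods* (2001), §1.1 (ℝ⁰ is a point of volume 1), §1.2 rules (1)–(3), Conjecture 1,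
Problem 2 ("the dimension of the integral") [cite: KontsevichZagier2001, §1.2]; J. Ayoub, *Une version relative de la conjecture des
périodes de Kontsevich–Zagier* (2015), Rem. 1.2/1.5 (how many variables a rules-proof needs) — the source of the `d(1)` question as filed
by the two routes.  No definitions are introduced.
-/

noncomputable section

open MeasureTheory Set
open Literature.ModelTheory.ExponentialFields (IsSemialgebraic isSemialgebraic_univ)
open Literature.NumberTheory.Transcendental Literature.NumberTheory.Transcendental.KZ
open Summit.KontsevichZagierPeriods.KontsevichZagierPeriods.Theses
open Summit.KontsevichZagierPeriods.KontsevichZagierPeriods.ReducedPeriodRingNegative (value_eq_integrand_default)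
open Summit.KontsevichZagierPeriods.LowDimension.LowdimDimZero (domain_eq_univ_of_value_ne_zero)
open Summit.KontsevichZagierPeriods.DessinsDimensionOne.ExcursionBudgetDimZero
  (of_sub_of_mem_relationsLE_of_eqOn of_mem_relationsLE_of_dim_zero_of_value_eq_zero)
open Summit.KontsevichZagierPeriods.AbelContraction.AbelContractionLemma (of_mem_relationsLE_of_eqOn_zero)
open Summit.KontsevichZagierPeriods.AbelContraction.RealHyperellipticSector.Budget (value_eq_of_sub_mem_relationsLE)

namespace Summit.KontsevichZagierPeriods.KzOnePeriods

/-! ### Truncated rung 0 -/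

/-- **`KZ_≤0` inside dimension `0`** (truncated rung 0): two `0`-dimensional representations with the same value differ by
moves among `0`-dimensional representations.  If the common value is `0` both integrands vanish on their domains (rule (1b)
inside dimension `0`); otherwise both domains are the point and the integrands agree there (congruence, rule (1b) with a zero
representation).  [cite: KontsevichZagier2001, §1.2 Conjecture 1] -/
theorem KZ_leLE_zero : KZ_leLE 0 := by
  intro n m hn hm r r' hv
  obtain rfl := Nat.le_zero.mp hn
  obtain rfl := Nat.le_zero.mp hm
  show of r - of r' ∈ relationsLE 0
  by_cases h0 : r.value = 0
  · exact (relationsLE 0).sub_mem (of_mem_relationsLE_of_dim_zero_of_value_eq_zero r h0)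
      (of_mem_relationsLE_of_dim_zero_of_value_eq_zero r' (hv ▸ h0))
  have hd : r.domain = univ := domain_eq_univ_of_value_ne_zero r h0
  have hd' : r'.domain = univ := domain_eq_univ_of_value_ne_zero r' fun h => h0 (hv.trans h)
  refine of_sub_of_mem_relationsLE_of_eqOn le_rfl (hd'.trans hd.symm) fun x _ => ?_
  rw [Subsingleton.elim x default, ← value_eq_integrand_default r hd, ← value_eq_integrand_default r' hd', hv]

/-! (The untruncated rung 0, `KZ_le 0`, follows by `KZ_le_of_KZ_leLE KZ_leLE_zero`; it is already landed as
`KzOnePeriods.KZ_le_zero` in `Theorems/KzOnePeriodsGaps.lean`, so it is not restated here.)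

### Truncated rational rung 1 (in tree)

`KZ_≤1` inside dimension `1` for RATIONAL shapes is PROVED IN TREE, verbatim in the ladder's quantifier shape, as
`AbelContraction.RealHyperellipticSector.Port.Dlog.kzConjectureLE_of_dim_le_one` (Baker + the dimension-certified normal
form; closed item stmt-KontsevichZagierPeriods-3750 `DimensionBudget.BakerSectorDimOne`); it is cited by name in
`ladder_statusLE` below and not restated. -/

/-! ### Padding a point into dimension 1 inside the budget -/

/-- **Padding inside the budget `1`**: every `0`-dimensional representation `Z` is congruent, modulo `relationsLE 1`, to a
`1`-dimensional one.  Over the empty domain `Z` is itself a truncated relation (value `0`); over the point, with (algebraic)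
value `c = Z.integrand pt`, the interval representation `[(0,1), c]` minus `Z` is ONE Newton–Leibniz move `1 → 0` with the
primitive `c·t` plus two null endpoints (REUSED `Port.AlgSplitK5.unit_slab_sub_pt_mem_relationsLE`).
[cite: KontsevichZagier2001, §1.2 rule (3)] -/
theorem exists_dimOne_sub_mem_relationsLE_one (Z : IntegralRep 0) :
    ∃ N : IntegralRep 1, of N - of Z ∈ relationsLE 1 := by
  classical
  rcases Set.eq_empty_or_nonempty Z.domain with hd | hd
  · -- empty domain: `Z` and the zero representation on `ℝ¹` are both truncated relations
    obtain ⟨N, hNd, hNi⟩ := exists_zeroRep (isSemialgebraic_univ (k := ℚ) (ι := Fin 1) (R := ℝ))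
    have hZ0 : Z.value = 0 := by rw [IntegralRep.value, hd]; simp
    exact ⟨N, (relationsLE 1).sub_mem (of_mem_relationsLE_of_eqOn_zero le_rfl N (by simp [hNi, EqOn]))
      (of_mem_relationsLE_of_dim_zero_of_value_eq_zero Z hZ0)⟩
  · -- the point: pad by one Newton–Leibniz move
    have hdu : Z.domain = univ := Subsingleton.eq_univ_of_nonempty hd
    obtain ⟨c, hc⟩ : ∃ c : ℝ, Z.integrand = fun _ => c :=
      ⟨Z.integrand default, funext fun x => by rw [Subsingleton.elim x default]⟩
    have hcalg : IsAlgebraic ℚ c := by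
      have h := Z.isSemialgebraicFunOn_integrand.isAlgebraic_apply (a := default) (by rw [hdu]; trivial)
        fun i => i.elim0
      simpa [hc] using h
    have hIoo : IsSemialgebraic ℚ {x : Fin 1 → ℝ | x 0 ∈ Ioo (0:ℝ) 1} := by
      simpa using KZ.BallPeeling.isSemialgebraic_Ioo₁ 0 1
    have hIcc : IsSemialgebraic ℚ {x : Fin 1 → ℝ | x 0 ∈ Icc (0:ℝ) 1} := by
      simpa using Summit.KontsevichZagierPeriods.HurwitzMicroSectors.NormalFormPrinciple.PiBox.Dlog.isSemialgebraic_Icc₁ 0 1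
    have hvol : volume {x : Fin 1 → ℝ | x 0 ∈ Ioo (0:ℝ) 1} ≠ ⊤ := by
      have e : {x : Fin 1 → ℝ | x 0 ∈ Ioo (0:ℝ) 1} = Set.pi univ fun _ => Ioo (0:ℝ) 1 := by
        ext x; simp [Fin.forall_fin_one]
      rw [e, Real.volume_pi_Ioo]
      simp
    obtain ⟨N, hNd, hNi⟩ : ∃ N : IntegralRep 1, N.domain = {x | x 0 ∈ Ioo (0:ℝ) 1} ∧ N.integrand = fun _ => c :=
      ⟨{ domain := {x | x 0 ∈ Ioo (0:ℝ) 1}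
         integrand := fun _ => c
         isSemialgebraic_domain := hIoo
         isSemialgebraicFunOn_integrand := isSemialgebraicFunOn_const_of_isAlgebraic hIoo hcalg
         integrableOn := integrableOn_const hvol }, rfl, rfl⟩
    refine ⟨N, ?_⟩
    refine Summit.KontsevichZagierPeriods.AbelContraction.RealHyperellipticSector.Port.AlgSplitK5.unit_slab_sub_pt_mem_relationsLE
      (fun _ => c) (fun t => c * t) ?_ ?_ ?_ ?_ N hNd (fun x _ => by simp [hNi]) Z hdu ?_
    · exact isSemialgebraicFunOn_const_mul_apply_of_isAlgebraic hIcc hcalg 0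
    · exact isSemialgebraicFunOn_const_of_isAlgebraic hIcc hcalg
    · fun_prop
    · intro t _
      exact ((hasDerivAt_id t).const_mul c).congr_deriv (mul_one c)
    · rw [hc]; funext; ring

/-! ### Truncated rung 1: reduction to dimension exactly 1, and its place among filed route items -/

/-- **`KZ_≤1` inside dimension `1` is decided on pairs of dimension exactly `1`**: the mixed cases `(0,1)`, `(1,0)` reduce to it
by padding (`exists_dimOne_sub_mem_relationsLE_one`) and soundness inside the budget, the case `(0,0)` is `KZ_leLE_zero`.
[cite: KontsevichZagier2001, §1.2 Conjecture 1] -/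
theorem KZ_leLE_one_iff_dimOne :
    KZ_leLE 1 ↔ ∀ (r r' : IntegralRep 1), r.value = r'.value → EquivalentLE 1 r r' := by
  refine ⟨fun h r r' hv => h le_rfl le_rfl r r' hv, fun h n m hn hm r r' hv => ?_⟩
  rcases Nat.le_one_iff_eq_zero_or_eq_one.mp hn with rfl | rfl <;>
    rcases Nat.le_one_iff_eq_zero_or_eq_one.mp hm with rfl | rfl
  · exact (KZ_leLE_zero le_rfl le_rfl r r' hv).mono zero_le_one
  · -- `(0,1)`: pad `r`
    obtain ⟨N, hN⟩ := exists_dimOne_sub_mem_relationsLE_one r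
    have hNv : N.value = r'.value := (value_eq_of_sub_mem_relationsLE hN).trans hv
    have e : of r - of r' = (of N - of r') - (of N - of r) := by abel
    show of r - of r' ∈ relationsLE 1
    rw [e]
    exact (relationsLE 1).sub_mem (h N r' hNv) hN
  · -- `(1,0)`: pad `r'`
    obtain ⟨N, hN⟩ := exists_dimOne_sub_mem_relationsLE_one r'
    have hNv : r.value = N.value := hv.trans (value_eq_of_sub_mem_relationsLE hN).symm
    have e : of r - of r' = (of r - of N) + (of N - of r') := by abel
    show of r - of r' ∈ relationsLE 1
    rw [e]
    exact (relationsLE 1).add_mem (h r N hNv) hN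
  · exact h r r' hv

/-- **The cell's gap G-LE1 is the negation of route item stmt-KontsevichZagierPeriods-6266**
(`DessinsDimensionOne.DimOneNeedsExcursion`: "some two 1-dimensional representations with equal values are not joined inside
relations_≤1", the pure form of that route's bet `d(1) = 2`).  [cite: KontsevichZagier2001, §1.2 Problem 2] -/
theorem KZ_leLE_one_iff_not_dimOneNeedsExcursion :
    KZ_leLE 1 ↔ ¬ DessinsDimensionOne.DimOneNeedsExcursion := by
  rw [KZ_leLE_one_iff_dimOne]
  unfold DessinsDimensionOne.DimOneNeedsExcursion
  simp only [not_exists, not_and, not_not]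
  rfl

/-- Route DessinsDimensionOne's pinned genus-2 Cauchy witness (open crux stmt-KontsevichZagierPeriods-6260) would refute the
truncated rung 1.  [cite: KontsevichZagier2001, §1.2 Problem 2] -/
theorem not_KZ_leLE_one_of_cauchyGenusTwoNotDimOne (h : DessinsDimensionOne.CauchyGenusTwoNotDimOne) : ¬ KZ_leLE 1 := by
  obtain ⟨r₁, r₂, -, -, -, -, hv, hnot⟩ := h
  exact fun hLE => hnot (hLE le_rfl le_rfl r₁ r₂ hv)

/-- Route DimensionBudget's open crux stmt-KontsevichZagierPeriods-3749 ("dimension 1 is NOT conservative") would refute the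
truncated rung 1 (KZ-equivalent representations have equal values, by soundness).  [cite: KontsevichZagier2001, §1.2 Problem 2] -/
theorem not_KZ_leLE_one_of_dimOneNotConservative (h : DimensionBudget.DimOneNotConservative) : ¬ KZ_leLE 1 := by
  obtain ⟨n, m, r, r', hn, hm, heq, hnot⟩ := h
  exact fun hLE => hnot (hLE hn hm r r' (Equivalent.value_eq_holds heq))

/-- The truncated rung 1 implies route DessinsDimensionOne's budget-2 crux stmt-KontsevichZagierPeriods-6261
(`DimLeOneBudgetTwo`: equal-valued representations of dimensions `≤ 1` are joined inside dimension `≤ 2`).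
[cite: KontsevichZagier2001, §1.2 Conjecture 1] -/
theorem dimLeOneBudgetTwo_of_KZ_leLE_one (h : KZ_leLE 1) : DessinsDimensionOne.DimLeOneBudgetTwo :=
  fun _ _ hn hm r r' hv => (h hn hm r r' hv).mono one_le_two

/-- Route DessinsDimensionOne's budget-2 crux stmt-KontsevichZagierPeriods-6261 implies the untruncated rung `KZ_le 1`.
[cite: KontsevichZagier2001, §1.2 Conjecture 1] -/
theorem KZ_le_one_of_dimLeOneBudgetTwo (h : DessinsDimensionOne.DimLeOneBudgetTwo) : KZ_le 1 :=
  fun _ _ hn hm r r' hv => EquivalentLE.equivalent (d := 2) (h hn hm r r' hv)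

/-- stmt-KontsevichZagierPeriods-6261 (`DessinsDimensionOne.DimLeOneBudgetTwo`, hypothesis "equal values") implies
stmt-KontsevichZagierPeriods-3751 (`DimensionBudget.DimOneWithinTwo`, hypothesis "KZ-equivalent"), by soundness.
[cite: KontsevichZagier2001, §1.2 Conjecture 1] -/
theorem dimOneWithinTwo_of_dimLeOneBudgetTwo (h : DessinsDimensionOne.DimLeOneBudgetTwo) :
    DimensionBudget.DimOneWithinTwo :=
  fun _ _ hn hm r r' heq => h hn hm r r' (Equivalent.value_eq_holds heq)

/-! ### Summary -/

/-- **Status of the truncated ladder through rung 1** (cell pub-kz1p, LEMMAS.md / GAPS.md G-LE1): truncated rung 0 holds;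
the rational truncated rung 1 holds (Baker, in tree); the full truncated rung 1 is EQUIVALENT to the negation of the open route item
stmt-KontsevichZagierPeriods-6266 and sits above the budget-2 item stmt-…-6261, which sits above the untruncated rung `KZ_le 1`.
[cite: KontsevichZagier2001, §1.2] -/
theorem ladder_statusLE :
    KZ_leLE 0 ∧
    (∀ ⦃n m : ℕ⦄, n ≤ 1 → m ≤ 1 → ∀ (r : IntegralRep n) (r' : IntegralRep m),
      r.IsRational → r'.IsRational → r.value = r'.value → EquivalentLE 1 r r') ∧
    (KZ_leLE 1 ↔ ¬ DessinsDimensionOne.DimOneNeedsExcursion) ∧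
    (KZ_leLE 1 → DessinsDimensionOne.DimLeOneBudgetTwo) ∧
    (DessinsDimensionOne.DimLeOneBudgetTwo → KZ_le 1) ∧
    (DessinsDimensionOne.DimLeOneBudgetTwo → DimensionBudget.DimOneWithinTwo) :=
  ⟨KZ_leLE_zero, Summit.KontsevichZagierPeriods.AbelContraction.RealHyperellipticSector.Port.Dlog.kzConjectureLE_of_dim_le_one,
    KZ_leLE_one_iff_not_dimOneNeedsExcursion, dimLeOneBudgetTwo_of_KZ_leLE_one, KZ_le_one_of_dimLeOneBudgetTwo,
    dimOneWithinTwo_of_dimLeOneBudgetTwo⟩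

end Summit.KontsevichZagierPeriods.KzOnePeriods

end
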